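import Summits.BirchSwinnertonDyer.BirchSwinnertonDyer.Theorems.AdditiveKolyvaginRoadManinFrameResidueProperRTameTwistSplit
import HarnessLib

/-!
# Route `AdditiveKolyvaginRoad`, crux `ManinFrameResidueProperR` (stmt-BirchSwinnertonDyer-20709), line
# `birth`, stub TDS: `Γ₀(N)`-bookkeeping for the tame-twist lever WITH CONTROL MODULO `4` — `--supports`

Cell `pub/bsd-wall`, seat `bsd-wall-manin-p1` g3. Refinement of `…RTameTwistGamma0` / `…RTameTwistSplit`: the
auxiliary prime `d′ ≡ d (mod c)` is now also taken `≡ 3 (mod 4)`, so that `gcd(d′ − 1, p − 1) = 2`; this lets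
the lever run on the larger locus «no `ℓ ∥ N` with `ℓ ≡ ±a_ℓ (mod p)`» (`…RTameTwistPlus`). Call `γ = (a b; c d)`
**4-adjustable** if it is adjustable (`c ≠ 0`, `d ≢ 1 (mod p)`, `d ≢ 1 (mod r)` for odd primes `r ∣ p − 1`
dividing `c`) and `4 ∣ c ⟹ d ≡ 3 (mod 4)`.
* `exists_prime_eq_add_mul_of_adjustable4`: a 4-adjustable `γ` has a prime `d′ = d + kc > N`, `d′ ≡ 3 (4)`,
  `p ∤ d′ − 1`, `r ∤ d′ − 1`.
* `exists_eq_mul_adjustable4`: every `γ` with `c ≠ 0`, (`3 ∣ p − 1`, `3 ∣ c` ⟹ `d ≡ 1 (3)`) and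
  (`4 ∣ c` ⟹ `d ≡ 1 (4)`) is a product of two 4-adjustable elements (`d₂ ≡ 3d (mod 4)`).
* `four_dvd_pow_four_entry`: `4 ∣ (γ⁴)₁₀ ⟹ (γ⁴)₁₁ ≡ 1 (4)` for all `γ ∈ SL(2, ℤ)` (check in `SL₂(ℤ/4)`).
Everything proved; no definition.
-/

set_option autoImplicit false
set_option linter.dupNamespace false

noncomputable section

open scoped MatrixGroups Classical

open CongruenceSubgroup Matrix

namespace Summit.BirchSwinnertonDyer.BirchSwinnertonDyer.Theorems.ManinFrameResidueProperRTameTwist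

/-! ### §1 A prime denominator `≡ 3 (mod 4)` -/

section PrimeDenominator4

variable {N : ℕ} {p : ℕ}

/-- Residues modulo `4`: given `X, M` with (`M = 0 ⟹ X = 3`) and (`M = 2 ⟹ X ∉ {0, 2}`), some `J` has
`X + J M = 3` (plumbing, `decide`). [folklore] -/
theorem zmod4_exists_add_mul_eq_three :
    ∀ X M : ZMod 4, (M = 0 → X = 3) → (M = 2 → X ≠ 0 ∧ X ≠ 2) → ∃ J : ZMod 4, X + J * M = 3 := by
  decide

/-- **Dirichlet step with control mod `4`.** A 4-adjustable `γ = (a b; c d) ∈ Γ₀(N)` (`p ∣ N` prime) has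
`k ∈ ℤ` and a prime `d′ = d + kc > N` with `4 ∤ d′ − 1` (i.e. `d′ ≡ 3 (mod 4)`), `p ∤ d′ − 1` and `r ∤ d′ − 1`
for every odd prime `r ∣ p − 1`: as `exists_prime_eq_add_mul_of_adjustable`, in the class `x (mod 4cR)`,
`x ≡ d (c)`, `x ≡ 2 (R)`, `x ≡ 3 (4)`. [folklore] -/
theorem exists_prime_eq_add_mul_of_adjustable4 (hp : p.Prime) (hpN : p ∣ N) (γ : Gamma0 N)
    (hc : (γ : SL(2, ℤ)) 1 0 ≠ 0) (hdp : ¬ (p : ℤ) ∣ (γ : SL(2, ℤ)) 1 1 - 1)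
    (hdr : ∀ r : ℕ, r.Prime → r ≠ 2 → r ∣ p - 1 → (r : ℤ) ∣ (γ : SL(2, ℤ)) 1 0 →
      ¬ (r : ℤ) ∣ (γ : SL(2, ℤ)) 1 1 - 1)
    (h4 : (4 : ℤ) ∣ (γ : SL(2, ℤ)) 1 0 → (4 : ℤ) ∣ (γ : SL(2, ℤ)) 1 1 - 3) :
    ∃ (k : ℤ) (d' : ℕ), d'.Prime ∧ N < d' ∧ ((d' : ℤ) = (γ : SL(2, ℤ)) 1 1 + k * (γ : SL(2, ℤ)) 1 0) ∧
      ¬ p ∣ d' - 1 ∧ (∀ r : ℕ, r.Prime → r ≠ 2 → r ∣ p - 1 → ¬ r ∣ d' - 1) ∧ ¬ 4 ∣ d' - 1 := by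
  set c : ℤ := (γ : SL(2, ℤ)) 1 0 with hcdef
  set d : ℤ := (γ : SL(2, ℤ)) 1 1 with hddef
  have hcop : IsCoprime d c := by
    refine ⟨(γ : SL(2, ℤ)) 0 0, -((γ : SL(2, ℤ)) 0 1), ?_⟩
    have := entry_det γ
    linear_combination this
  set P : Finset ℕ := ((p - 1).primeFactors.erase 2).filter (fun r ↦ ¬ (r : ℤ) ∣ c) with hPdef
  obtain ⟨R, hRdef⟩ : ∃ R : ℕ, R = ∏ r ∈ P, r := ⟨_, rfl⟩
  have hPprime : ∀ r ∈ P, r.Prime := fun r hr ↦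
    Nat.prime_of_mem_primeFactors (Finset.mem_of_mem_erase (Finset.mem_filter.mp hr).1)
  have hPndvd : ∀ r ∈ P, ¬ (r : ℤ) ∣ c := fun r hr ↦ (Finset.mem_filter.mp hr).2
  have hPne2 : ∀ r ∈ P, r ≠ 2 := fun r hr ↦ Finset.ne_of_mem_erase (Finset.mem_filter.mp hr).1
  have hRc : IsCoprime (R : ℤ) c := by
    rw [hRdef, Nat.cast_prod]
    exact IsCoprime.prod_left fun r hr ↦
      Literature.NumberTheory.ModularForms.OrdinaryCusps.isCoprime_natCast_of_not_dvd (hPprime r hr) (hPndvd r hr)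
  have hR2 : ¬ (2 : ℤ) ∣ R := by
    rw [hRdef, Nat.cast_prod]
    intro h
    obtain ⟨r, hr, h2r⟩ := (Prime.dvd_finsetProd_iff Int.prime_two _).mp h
    have h2r' : (2 : ℕ) ∣ r := by exact_mod_cast h2r
    exact hPne2 r hr (((hPprime r hr).eq_one_or_self_of_dvd 2 h2r').resolve_left (by norm_num)).symm
  have hR0 : R ≠ 0 := by
    rw [hRdef]; exact Finset.prod_ne_zero_iff.mpr fun r hr ↦ (hPprime r hr).ne_zero
  obtain ⟨u, v, huv⟩ := hRc
  obtain ⟨x, hxdef⟩ : ∃ x : ℤ, x = d * u * R + 2 * v * c := ⟨_, rfl⟩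
  have hu : IsCoprime u c := ⟨R, v, by linear_combination huv⟩
  have hRc' : IsCoprime (R : ℤ) c := ⟨u, v, huv⟩
  have hxc : IsCoprime x c := by
    have h1 : IsCoprime (d * u * R) c := (hcop.mul_left hu).mul_left hRc'
    rw [hxdef, show d * u * R + 2 * v * c = d * u * R + c * (2 * v) by ring]
    exact h1.add_mul_left_left (2 * v)
  have h2R : IsCoprime (2 : ℤ) R :=
    Literature.NumberTheory.ModularForms.OrdinaryCusps.isCoprime_natCast_of_not_dvd Nat.prime_two hR2
  have hxR : IsCoprime x R := by
    have hv : IsCoprime v (R : ℤ) := ⟨c, u, by linear_combination huv⟩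
    have hcR : IsCoprime c (R : ℤ) := ⟨v, u, by linear_combination huv⟩
    have h3 : IsCoprime (2 * v * c) (R : ℤ) := (h2R.mul_left hv).mul_left hcR
    rw [hxdef, show d * u * R + 2 * v * c = 2 * v * c + R * (d * u) by ring]
    exact h3.add_mul_left_left (d * u)
  have hxd : c ∣ x - d := ⟨v * (2 - d), by rw [hxdef]; linear_combination d * huv⟩
  -- adjust the class modulo `4`
  set M : ℤ := c * R with hMdef
  have h4R : IsCoprime (4 : ℤ) R := by
    have := h2R.pow_left (m := 2); norm_num at this; exact this
  have hM4c : (4 : ℤ) ∣ M → (4 : ℤ) ∣ c := fun h ↦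
    h4R.dvd_of_dvd_mul_right (by rw [hMdef] at h; exact h)
  have hM2c : (2 : ℤ) ∣ M → (2 : ℤ) ∣ c := fun h ↦
    h2R.dvd_of_dvd_mul_right (by rw [hMdef] at h; exact h)
  have hX3 : ((M : ℤ) : ZMod 4) = 0 → ((x : ℤ) : ZMod 4) = 3 := by
    intro hM0
    have h4M : (4 : ℤ) ∣ M := (ZMod.intCast_zmod_eq_zero_iff_dvd M 4).mp hM0
    have h4c := hM4c h4M
    have : (4 : ℤ) ∣ x - 3 := by
      rw [show x - 3 = (x - d) + (d - 3) by ring]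
      exact dvd_add (h4c.trans hxd) (h4 h4c)
    have := (ZMod.intCast_eq_intCast_iff_dvd_sub 3 x 4).mpr this
    simpa using this.symm
  have hXodd : ((M : ℤ) : ZMod 4) = 2 → ((x : ℤ) : ZMod 4) ≠ 0 ∧ ((x : ℤ) : ZMod 4) ≠ 2 := by
    intro hM2
    have h2M : (2 : ℤ) ∣ M := by
      have h := (ZMod.intCast_eq_intCast_iff_dvd_sub 2 M 4).mp (by simpa using hM2.symm)
      have : (2 : ℤ) ∣ M - 2 := (show (2 : ℤ) ∣ 4 by norm_num).trans h
      simpa using (dvd_sub_comm.mp this |> fun h' ↦ (dvd_sub (dvd_refl (2 : ℤ)) h'))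
    have h2c := hM2c h2M
    -- `d` odd, `x ≡ d (mod 2)`
    have hxodd : ¬ (2 : ℤ) ∣ x := by
      intro hx
      have hd2 : (2 : ℤ) ∣ d := by
        have := dvd_sub hx (h2c.trans hxd); simpa using this
      exact Int.prime_two.not_unit (hcop.isUnit_of_dvd' hd2 h2c)
    constructor
    · intro h0
      exact hxodd ((show (2 : ℤ) ∣ 4 by norm_num).trans ((ZMod.intCast_zmod_eq_zero_iff_dvd x 4).mp h0))
    · intro h2
      have h := (ZMod.intCast_eq_intCast_iff_dvd_sub 2 x 4).mp (by simpa using h2.symm)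
      exact hxodd (by simpa using dvd_sub ((show (2 : ℤ) ∣ 4 by norm_num).trans h) (dvd_refl (2 : ℤ)) |>.neg_right
        |> fun h' ↦ by simpa using h')
  obtain ⟨J, hJ⟩ := zmod4_exists_add_mul_eq_three _ _ hX3 hXodd
  set x' : ℤ := x + (J.val : ℤ) * M with hx'def
  have hx'3 : (4 : ℤ) ∣ x' - 3 := by
    have : ((x' : ℤ) : ZMod 4) = 3 := by
      rw [hx'def]; push_cast; rw [ZMod.natCast_zmod_val]; exact hJ
    have := (ZMod.intCast_eq_intCast_iff_dvd_sub 3 x' 4).mp (by simpa using this.symm)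
    simpa using this
  have hx'c : IsCoprime x' c := by
    rw [hx'def, hMdef, show x + (J.val : ℤ) * (c * R) = x + c * ((J.val : ℤ) * R) by ring]
    exact hxc.add_mul_left_left _
  have hx'R : IsCoprime x' R := by
    rw [hx'def, hMdef, show x + (J.val : ℤ) * (c * R) = x + R * ((J.val : ℤ) * c) by ring]
    exact hxR.add_mul_left_left _
  have hx'4 : IsCoprime x' 4 := by
    obtain ⟨t, ht⟩ := hx'3
    rw [show x' = 3 + 4 * t by linear_combination ht]
    have : IsCoprime (3 : ℤ) 4 := by rw [Int.isCoprime_iff_gcd_eq_one]; decide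
    exact this.add_mul_left_left t
  have hq0 : (4 * M).natAbs ≠ 0 := by
    rw [Int.natAbs_ne_zero]
    exact mul_ne_zero (by norm_num) (mul_ne_zero hc (by exact_mod_cast hR0))
  have hxq : IsCoprime x' ((4 * M).natAbs : ℤ) := by
    rw [Int.natCast_natAbs]
    have h : IsCoprime x' (4 * M) := hx'4.mul_right (hx'c.mul_right hx'R)
    rcases abs_choice (4 * M) with h' | h' <;> rw [h']
    · exact h
    · exact h.neg_right
  obtain ⟨d', hd'N, hd'p, hd'x⟩ := Nat.forall_exists_prime_gt_and_zmodEq N hq0 hxq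
  have hmodq : 4 * M ∣ x' - d' := by
    have h := hd'x.dvd
    rwa [Int.natCast_natAbs, abs_dvd] at h
  have hmod4 : (4 : ℤ) ∣ x' - d' := (dvd_mul_right 4 M).trans hmodq
  have hmodM : M ∣ x' - d' := (dvd_mul_left M 4).trans hmodq
  have hmodc : c ∣ x - d' := by
    have h1 : c ∣ x' - d' := (dvd_mul_right c R).trans hmodM
    have h2 : c ∣ x' - x := ⟨(J.val : ℤ) * R, by rw [hx'def, hMdef]; ring⟩
    have := dvd_sub h1 h2; rwa [show x' - d' - (x' - x) = x - (d' : ℤ) by ring] at this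
  have hmodR : (R : ℤ) ∣ x - d' := by
    have h1 : (R : ℤ) ∣ x' - d' := (dvd_mul_left (R : ℤ) c).trans hmodM
    have h2 : (R : ℤ) ∣ x' - x := ⟨(J.val : ℤ) * c, by rw [hx'def, hMdef]; ring⟩
    have := dvd_sub h1 h2; rwa [show x' - d' - (x' - x) = x - (d' : ℤ) by ring] at this
  obtain ⟨k, hk⟩ : c ∣ d' - d := by
    rw [show (d' : ℤ) - d = (x - d) - (x - d') by ring]
    exact dvd_sub hxd hmodc
  have hcast : ((d' - 1 : ℕ) : ℤ) = (d' : ℤ) - 1 := by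
    rw [Nat.cast_sub hd'p.one_lt.le, Nat.cast_one]
  refine ⟨k, d', hd'p, hd'N, by linear_combination hk, ?_, ?_, ?_⟩
  · intro h
    have hpc : (p : ℤ) ∣ c := (Int.natCast_dvd_natCast.mpr hpN).trans (natCast_dvd_entry10 γ)
    have h1 : (p : ℤ) ∣ (d' : ℤ) - 1 := by rw [← hcast]; exact_mod_cast h
    apply hdp
    rw [show d - 1 = ((d' : ℤ) - 1) - (d' - d) by ring]
    exact dvd_sub h1 (hpc.trans ⟨k, hk⟩)
  · intro r hr hr2 hrp h
    have h1 : (r : ℤ) ∣ (d' : ℤ) - 1 := by rw [← hcast]; exact_mod_cast h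
    by_cases hrc : (r : ℤ) ∣ c
    · apply hdr r hr hr2 hrp hrc
      rw [show d - 1 = ((d' : ℤ) - 1) - (d' - d) by ring]
      exact dvd_sub h1 (hrc.trans ⟨k, hk⟩)
    · have hrP : r ∈ P := by
        rw [hPdef, Finset.mem_filter]
        refine ⟨Finset.mem_erase.mpr ⟨hr2, ?_⟩, hrc⟩
        exact Nat.mem_primeFactors.mpr ⟨hr, hrp, Nat.sub_ne_zero_of_lt hp.one_lt⟩
      have hrR : (r : ℤ) ∣ R := by
        rw [hRdef, Nat.cast_prod]; exact Finset.dvd_prod_of_mem _ hrP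
      have hx2 : (r : ℤ) ∣ x - 2 := by
        rw [show x - 2 = (R : ℤ) * (u * (d - 2)) by rw [hxdef]; linear_combination (2 : ℤ) * huv]
        exact hrR.trans (dvd_mul_right _ _)
      have h3 : (r : ℤ) ∣ (x - 2) - (x - d') - ((d' : ℤ) - 1) :=
        dvd_sub (dvd_sub hx2 (hrR.trans hmodR)) h1
      rw [show (x - 2) - (x - d') - ((d' : ℤ) - 1) = -1 by ring, dvd_neg] at h3
      have := Int.eq_one_of_dvd_one (Int.natCast_nonneg r) h3
      exact hr.one_lt.ne' (by exact_mod_cast this)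
  · intro h
    have h1 : (4 : ℤ) ∣ (d' : ℤ) - 1 := by rw [← hcast]; exact_mod_cast h
    have h2 : (4 : ℤ) ∣ ((d' : ℤ) - 1) - (x' - 3) + (x' - d') := dvd_add (dvd_sub h1 hx'3) hmod4
    rw [show ((d' : ℤ) - 1) - (x' - 3) + (x' - d') = 2 by ring] at h2
    exact absurd (Int.le_of_dvd two_pos h2) (by norm_num)

end PrimeDenominator4

end Summit.BirchSwinnertonDyer.BirchSwinnertonDyer.Theorems.ManinFrameResidueProperRTameTwist

end
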